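import Mathlib
import Summits.Ventures.PercRepro2.PosClassCut

/-!
# The closed family of the (TB13) line: {(TB13), (OS)} passes every cut vertex
(blind cell PercRepro2, p5 g8, 2026-08-26; `proofs/P5-POSCLASS.md` §2′, STATUS 02:23:47Z)

The candidates (D) `0 ≤ red` and (B) `0 ≤ red + core` of `PosClass.ClassTriple` are FALSE ((B) at
7 vertices, kit j248386; (D) at 8 vertices by `stat_red_of_cut` at a pendant — `P5-POSCLASS.md`
§4), so `classTriple_of_cut` has hypotheses that fail on some instances.  The family that IS closed
under the cut-vertex transport is the pair {(TB13) `0 ≤ out`, (OS) `0 ≤ out + red` (and its blue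
mirror)} — (OS) = `N(f_u f_v; w ∉ S)` is the pendant layer of the typed BHK 1.1 with asymmetric
avoid sets (`P5-COUPLING.md` §6).  With the copy-swap symmetry of the `w`-side counts
(`pairCount_kRed_eq_kBlue`): **`stat_os_of_cut`** `(out + red)_w = H_x · (cOut + cRed) +
(out + red)_x · (cRed + cCore)` and the rearrangement `out_w = H_x · cOut + out_x · cCore +
(out + red)_x · cBlue + (out + blue)_x · cRed` (`H` = typed Harris `0 ≤ out + red + blue + core`),
hence **`tb13_of_cut'`**, **`os_of_cut`**, **`classPair_of_cut`**: the pair at `x` (on the `s`-side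
profile) implies the pair at `w`.  Own work; standard axioms.
-/

namespace Summit.Ventures.PercRepro2

namespace PosClass

open CovForm A3InactiveTyped CutV TB14Cut

section Swap

variable {V : Type*} {E : Type*} [Fintype E] [DecidableEq E] {R : Type*} [Field R]

/-- The copy swap exchanges the red-only and blue-only classes: their counts agree. -/
lemma pairCount_kRed_eq_kBlue (F : Finset E) (z : Config E) (ends : E → Sym2 V) (a b : V) :
    pairCount F z (kRed ends a b : Config E → Config E → R) = pairCount F z (kBlue ends a b) := by
  rw [pairCount_swap]
  congr 1
  funext y y'
  unfold kRed kBlue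
  ring

end Swap

section OS

variable {V : Type*} {E : Type*} [Fintype E] [DecidableEq E] {R : Type*} [Field R]
  [LinearOrder R] [IsStrictOrderedRing R] {ends : E → Sym2 V} {x : V} {VA VB : Set V}
  {EA EB : Set E} [DecidablePred (· ∈ EA)] [DecidablePred (· ∈ EB)]

omit [LinearOrder R] [IsStrictOrderedRing R] in
/-- **Transport of (OS)**: `(out + red)_w = H_x · (cOut + cRed) + (out + red)_x · (cRed + cCore)`. -/
theorem stat_os_of_cut (h : IsCut ends x VA VB EA EB) (F : Finset E) (z : Config E)
    {s u v w : V} (hs : s ∈ VA ∪ {x}) (hu : u ∈ VA ∪ {x}) (hv : v ∈ VA ∪ {x}) (hw : w ∈ VB) :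
    (stat F z ends s u v (kOut ends s w) : R) + stat F z ends s u v (kRed ends s w) =
      (stat (sideFree EA F) (restrict EA z) ends s u v (kOut ends s x) +
        stat (sideFree EA F) (restrict EA z) ends s u v (kRed ends s x) +
        stat (sideFree EA F) (restrict EA z) ends s u v (kBlue ends s x) +
        stat (sideFree EA F) (restrict EA z) ends s u v (kCore ends s x)) *
        (pairCount (sideFree EB F) (restrict EB z) (kOut ends x w) +
          pairCount (sideFree EB F) (restrict EB z) (kRed ends x w)) +
      (stat (sideFree EA F) (restrict EA z) ends s u v (kOut ends s x) +
        stat (sideFree EA F) (restrict EA z) ends s u v (kRed ends s x)) *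
        (pairCount (sideFree EB F) (restrict EB z) (kRed ends x w) +
          pairCount (sideFree EB F) (restrict EB z) (kCore ends x w)) := by
  rw [stat_out_of_cut h F z hs hu hv hw, stat_red_of_cut h F z hs hu hv hw,
    ← pairCount_kRed_eq_kBlue (sideFree EB F) (restrict EB z) ends x w]
  ring

omit [LinearOrder R] [IsStrictOrderedRing R] in
/-- **Transport of the blue (OS)**: `(out + blue)_w = H_x · (cOut + cBlue) + (out + blue)_x ·
(cBlue + cCore)`. -/
theorem stat_osb_of_cut (h : IsCut ends x VA VB EA EB) (F : Finset E) (z : Config E)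
    {s u v w : V} (hs : s ∈ VA ∪ {x}) (hu : u ∈ VA ∪ {x}) (hv : v ∈ VA ∪ {x}) (hw : w ∈ VB) :
    (stat F z ends s u v (kOut ends s w) : R) + stat F z ends s u v (kBlue ends s w) =
      (stat (sideFree EA F) (restrict EA z) ends s u v (kOut ends s x) +
        stat (sideFree EA F) (restrict EA z) ends s u v (kRed ends s x) +
        stat (sideFree EA F) (restrict EA z) ends s u v (kBlue ends s x) +
        stat (sideFree EA F) (restrict EA z) ends s u v (kCore ends s x)) *
        (pairCount (sideFree EB F) (restrict EB z) (kOut ends x w) +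
          pairCount (sideFree EB F) (restrict EB z) (kBlue ends x w)) +
      (stat (sideFree EA F) (restrict EA z) ends s u v (kOut ends s x) +
        stat (sideFree EA F) (restrict EA z) ends s u v (kBlue ends s x)) *
        (pairCount (sideFree EB F) (restrict EB z) (kBlue ends x w) +
          pairCount (sideFree EB F) (restrict EB z) (kCore ends x w)) := by
  rw [stat_out_of_cut h F z hs hu hv hw, stat_blue_of_cut h F z hs hu hv hw,
    pairCount_kRed_eq_kBlue (sideFree EB F) (restrict EB z) ends x w]
  ring

/-- **(TB13) passes a cut vertex with (OS)**: `out_w = H_x · cOut + out_x · cCore + (out + red)_x ·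
cBlue + (out + blue)_x · cRed ≥ 0` given (TB13) and the two (OS) at `x`. -/
theorem tb13_of_cut' (h : IsCut ends x VA VB EA EB) (F : Finset E) (z : Config E) {s u v w : V}
    (hs : s ∈ VA ∪ {x}) (hu : u ∈ VA ∪ {x}) (hv : v ∈ VA ∪ {x}) (hw : w ∈ VB)
    (hout : 0 ≤ (stat (sideFree EA F) (restrict EA z) ends s u v (kOut ends s x) : R))
    (hosr : 0 ≤ (stat (sideFree EA F) (restrict EA z) ends s u v (kOut ends s x) : R) +
      stat (sideFree EA F) (restrict EA z) ends s u v (kRed ends s x))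
    (hosb : 0 ≤ (stat (sideFree EA F) (restrict EA z) ends s u v (kOut ends s x) : R) +
      stat (sideFree EA F) (restrict EA z) ends s u v (kBlue ends s x)) :
    0 ≤ (stat F z ends s u v (kOut ends s w) : R) := by
  rw [stat_out_of_cut h F z hs hu hv hw]
  have hH : (0 : R) ≤ stat (sideFree EA F) (restrict EA z) ends s u v (kOut ends s x) +
      stat (sideFree EA F) (restrict EA z) ends s u v (kRed ends s x) +
      stat (sideFree EA F) (restrict EA z) ends s u v (kBlue ends s x) +
      stat (sideFree EA F) (restrict EA z) ends s u v (kCore ends s x) := by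
    rw [stat_sum_classes]
    exact stat_one_nonneg _ _ ends s u v
  have c1 := pairCount_nonneg' (R := R) (sideFree EB F) (restrict EB z) (kOut ends x w)
    (kOut_nonneg ends x w)
  have c2 := pairCount_nonneg' (R := R) (sideFree EB F) (restrict EB z) (kRed ends x w)
    (kRed_nonneg ends x w)
  have c3 := pairCount_nonneg' (R := R) (sideFree EB F) (restrict EB z) (kBlue ends x w)
    (kBlue_nonneg ends x w)
  have c4 := pairCount_nonneg' (R := R) (sideFree EB F) (restrict EB z) (kCore ends x w)
    (kCore_nonneg ends x w)
  have t1 := mul_nonneg hH c1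
  have t2 := mul_nonneg hout c4
  have t3 := mul_nonneg hosr c3
  have t4 := mul_nonneg hosb c2
  linarith

/-- **(OS) passes a cut vertex by itself** (with typed Harris). -/
theorem os_of_cut (h : IsCut ends x VA VB EA EB) (F : Finset E) (z : Config E) {s u v w : V}
    (hs : s ∈ VA ∪ {x}) (hu : u ∈ VA ∪ {x}) (hv : v ∈ VA ∪ {x}) (hw : w ∈ VB)
    (hosr : 0 ≤ (stat (sideFree EA F) (restrict EA z) ends s u v (kOut ends s x) : R) +
      stat (sideFree EA F) (restrict EA z) ends s u v (kRed ends s x)) :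
    0 ≤ (stat F z ends s u v (kOut ends s w) : R) + stat F z ends s u v (kRed ends s w) := by
  rw [stat_os_of_cut h F z hs hu hv hw]
  have hH : (0 : R) ≤ stat (sideFree EA F) (restrict EA z) ends s u v (kOut ends s x) +
      stat (sideFree EA F) (restrict EA z) ends s u v (kRed ends s x) +
      stat (sideFree EA F) (restrict EA z) ends s u v (kBlue ends s x) +
      stat (sideFree EA F) (restrict EA z) ends s u v (kCore ends s x) := by
    rw [stat_sum_classes]
    exact stat_one_nonneg _ _ ends s u v
  have c1 := pairCount_nonneg' (R := R) (sideFree EB F) (restrict EB z) (kOut ends x w)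
    (kOut_nonneg ends x w)
  have c2 := pairCount_nonneg' (R := R) (sideFree EB F) (restrict EB z) (kRed ends x w)
    (kRed_nonneg ends x w)
  have c4 := pairCount_nonneg' (R := R) (sideFree EB F) (restrict EB z) (kCore ends x w)
    (kCore_nonneg ends x w)
  exact add_nonneg (mul_nonneg hH (add_nonneg c1 c2)) (mul_nonneg hosr (add_nonneg c2 c4))

/-- The blue (OS) passes a cut vertex by itself. -/
theorem osb_of_cut (h : IsCut ends x VA VB EA EB) (F : Finset E) (z : Config E) {s u v w : V}
    (hs : s ∈ VA ∪ {x}) (hu : u ∈ VA ∪ {x}) (hv : v ∈ VA ∪ {x}) (hw : w ∈ VB)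
    (hosb : 0 ≤ (stat (sideFree EA F) (restrict EA z) ends s u v (kOut ends s x) : R) +
      stat (sideFree EA F) (restrict EA z) ends s u v (kBlue ends s x)) :
    0 ≤ (stat F z ends s u v (kOut ends s w) : R) + stat F z ends s u v (kBlue ends s w) := by
  rw [stat_osb_of_cut h F z hs hu hv hw]
  have hH : (0 : R) ≤ stat (sideFree EA F) (restrict EA z) ends s u v (kOut ends s x) +
      stat (sideFree EA F) (restrict EA z) ends s u v (kRed ends s x) +
      stat (sideFree EA F) (restrict EA z) ends s u v (kBlue ends s x) +
      stat (sideFree EA F) (restrict EA z) ends s u v (kCore ends s x) := by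
    rw [stat_sum_classes]
    exact stat_one_nonneg _ _ ends s u v
  have c1 := pairCount_nonneg' (R := R) (sideFree EB F) (restrict EB z) (kOut ends x w)
    (kOut_nonneg ends x w)
  have c3 := pairCount_nonneg' (R := R) (sideFree EB F) (restrict EB z) (kBlue ends x w)
    (kBlue_nonneg ends x w)
  have c4 := pairCount_nonneg' (R := R) (sideFree EB F) (restrict EB z) (kCore ends x w)
    (kCore_nonneg ends x w)
  exact add_nonneg (mul_nonneg hH (add_nonneg c1 c3)) (mul_nonneg hosb (add_nonneg c3 c4))

/-- **The class pair** at a profile: (TB13) `0 ≤ out` and (OS) `0 ≤ out + red`, `0 ≤ out + blue` —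
the family closed under the cut-vertex transport. -/
def ClassPair (F : Finset E) (z : Config E) (ends : E → Sym2 V) (s u v w : V) : Prop :=
  0 ≤ (stat F z ends s u v (kOut ends s w) : R) ∧
  0 ≤ (stat F z ends s u v (kOut ends s w) : R) + stat F z ends s u v (kRed ends s w) ∧
  0 ≤ (stat F z ends s u v (kOut ends s w) : R) + stat F z ends s u v (kBlue ends s w)

/-- **The class pair passes a cut vertex**: if `x` separates `w` from `s, u, v`, the pair
{(TB13), (OS)} at `x` on the `s`-side profile implies the pair at `w` on the full profile. -/
theorem classPair_of_cut (h : IsCut ends x VA VB EA EB) (F : Finset E) (z : Config E)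
    {s u v w : V} (hs : s ∈ VA ∪ {x}) (hu : u ∈ VA ∪ {x}) (hv : v ∈ VA ∪ {x}) (hw : w ∈ VB)
    (hx : ClassPair (R := R) (sideFree EA F) (restrict EA z) ends s u v x) :
    ClassPair (R := R) F z ends s u v w := by
  obtain ⟨hout, hosr, hosb⟩ := hx
  exact ⟨tb13_of_cut' h F z hs hu hv hw hout hosr hosb, os_of_cut h F z hs hu hv hw hosr,
    osb_of_cut h F z hs hu hv hw hosb⟩

end OS

end PosClass

end Summit.Ventures.PercRepro2
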